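/-
Copyright (c) 2026 the pub-hodgecm-mathlib formalisation cell (harness21).  Prover seat hodgecm-mathlib-K2E3-p32 (g2), Track B «K2-LIT», engine E3, unit U4 «Keys»; cell «U4-RAM»
— THE SOCKET :155 (U4f-χ₁-ram-one-d0B) AS A THEOREM: every non-split place, every residue characteristic; 2026-09-04.
KERNEL module: THEOREMS ONLY (no definition, no named fact, no `sorry`, no instance, no notation).
-/
import Summits.HodgeConjecture.HodgeConjecture.Theorems.K2E3KeysThmTwoDepthZeroBranchBInertAll            -- ★∕📤 p862903 (this seat): `ramifiedCharOne_depthZero_normTrivial_of_unramified` — :155 at EVERY inert place (H1 ★ p862488, H0 ★ p862842 through ★ (W-2) InertLeaf)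
import Summits.HodgeConjecture.HodgeConjecture.Theorems.R90S1KeysThmTwoDepthZeroBranchBRamifiedProvider   -- ★ p862851 (R90-C10-p08 (g2)): `R90.S1.exists_eta_of_reducible_ramified` — :155 at every RAMIFIED non-split place (tame: ★ p862481 wrapper + ★ R1∕R2∕R3 shell letters (R90-C10-p01∕p05); wild: ★ p862091 vacuous)
import HarnessLib

/-!
# K2 ∕ E3 «EllipticInputs», unit U4 «Keys» — THE SOCKET :155 (U4f-χ₁-ram-one-d0B) `sig_K2E3KeysThmTwoContractingRamifiedCharOneDepthZeroNormTrivial` AS A THEOREM: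
# KEYS' THEOREM §7 (2) FOR A RAMIFIED `χ₁` OF DEPTH ZERO IN BRANCH B (`χ₁ ∘ N = 1` on units), `χ₂ = 1`, AT EVERY NON-SPLIT PLACE — reducible `i(χ₁, 1)` ⟹ `χ₁ = η · ‖·‖^{1∕2}`
# [Keys1984 §3–§5, §7 Thm (2); Casselman1980 §3; Casselman1995 §6.4; Rogawski1990 §12.1–§12.2; MoyPrasad1996 §3]

Cell `pub/hodgecm-mathlib` (D-0151), crux H413 = `stmt-HodgeConjecture-24833`, route of record `HCCMUnconditional`; LINE-LEAD∕dealer K2E3-plan (g5), chair K2-lead (g2); cell «U4-RAM».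
THEOREMS ONLY; lane `--supports stmt-HodgeConjecture-24833 --as helper`, count-neutral.  THE TYPE of `keysThmTwo_ramifiedCharOne_depthZero_normTrivial` IS THE ∀-TEXT OF THE LINES SOCKET
`…Cruxes.H413.K2E3EllipticInputs.U4Keys.sig_K2E3KeysThmTwoContractingRamifiedCharOneDepthZeroNormTrivial` (ED. 8, K2E3-p06 (g4) cand v5 f5d0572a22ad1583) TOKEN FOR TOKEN, so the Lines
edition of :155 (dealer's pen) is the one-liner `keysThmTwo_ramifiedCharOne_depthZero_normTrivial` (HOME probe `K2/K2E3-p32/g2/probe_U4Keys155_inert_all.lean`, `type_of%` the socket).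

THE TIE (two cases on the place `v`, both providers ★):
* `v` UNRAMIFIED in `L` (inert; any residue characteristic — the dyadic inert places are NOT split off): ★∕📤 `K2E3KeysThmTwoDepthZeroBranchBInertAll.ramifiedCharOne_depthZero_normTrivial_of_unramified`
  (★ (W-2) `…InertLeaf.exists_eta_of_reducible_of_shellLetters` with the parity-free shell letters ★ p862488 `integral_Sh_one_anyChar`, ★ p862842 `integral_Sh_zero_anyChar` — the trace-one
  SHEAR of the Heisenberg chart; behind them the whole «U4-RAM» chain: ★ Z2A type vector, ★ Branch-B type basis, ★ determinant ∕ roots ∕ conversion (Z4∕Z5), ★ (II)-a scaling, ★ (II)-c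
  Casselman pair, ★ (II)-b1 skew-unit sign, ★ FILE L1 shear constant);
* `v` RAMIFIED in `L`: ★ p862851 `R90.S1.exists_eta_of_reducible_ramified` (R90-C10-p08 (g2); tame odd: ★ p862481 `…_of_shellIdentities_ram` (R90-C10-p05 (g0)) + ★ R1 `hscal` p862427, ★ R2
  `h0` p862526, ★ R3 `h1` p862795 (R90-C10-p01 (g2)); wild dyadic: ★ p862091 `chi_eq_one_of_mem_unitsIntegers_of_ramified_dyadic` contradicts `hram`).
In both cases the SECOND disjunct holds (`χ₁ = η · ‖·‖^{1∕2}`, `η` a continuous quadratic character extension): Keys' cases (b)–(d); case (a) `χ₁ = ‖·‖` is excluded by `hram`.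
HONEST LABEL: HC_CM is proved only modulo the 7 printed citations (2 remaining named inputs: hLiu418 = `stmt-HodgeConjecture-24832`, h413 = `stmt-HodgeConjecture-24833`) until rung 0
closes; count-neutral — this theorem PAYS the Lines socket :155 once the U4Keys edition cites it; :182 (positive depth) and the rest of the E3 organ stay OPEN; no printed citation is discharged.

## References
* [Keys1984] D. Keys, *Principal series representations of special unitary groups over local fields*, Compositio Math. 51 (1984), §3, §7 Theorem (2) p. 126.
* [Casselman1980] W. Casselman, *The unramified principal series of p-adic groups I*, Compositio Math. 40 (1980), §3.
* [Casselman1995] W. Casselman, *Introduction to the theory of admissible representations of `p`-adic reductive groups* (1995), §6.4, Thm. 6.6.2.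
* [Rogawski1990] J. Rogawski, *Automorphic representations of unitary groups in three variables*, Ann. of Math. Stud. 123 (1990), §12.1 p. 171, §12.2 (1)–(2) p. 173.
* [MoyPrasad1996] A. Moy, G. Prasad, *Jacquet functors and unrefined minimal K-types*, Comment. Math. Helv. 71 (1996), §3 (depth zero).
-/

set_option autoImplicit false
-- the mandated namespace has the single-problem summit's repeated segment (`HodgeConjecture.HodgeConjecture`)
set_option linter.dupNamespace false

noncomputable section

open NumberField IsDedekindDomain MeasureTheory
open scoped Matrix MatrixGroups WithZero Valued NNReal
open Literature.NumberTheory Literature.NumberTheory.Automorphic Literature.NumberTheory.Automorphic.UnitaryGroup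

namespace Summit.HodgeConjecture.HodgeConjecture.Cruxes.H413.K2E3KeysThmTwoContractingRamifiedCharOneDepthZero

open Summit.HodgeConjecture.HodgeConjecture.Cruxes.H413

/-- **KEYS' THEOREM §7 (2), RAMIFIED `χ₁` OF DEPTH ZERO, BRANCH B, `χ₂ = 1`, EVERY NON-SPLIT PLACE** — the ∀-text of the Lines socket
`…U4Keys.sig_K2E3KeysThmTwoContractingRamifiedCharOneDepthZeroNormTrivial` TOKEN FOR TOKEN: `v` a finite place of `L⁺` non-split in the CM field `L`; `χ₁ : (L ⊗ L⁺_v)ˣ → ℂˣ` continuous,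
non-unitary, contracting, NOT trivial on the integral units (`hram`), trivial on the principal units (`hdepth`), `χ₁(u·σu) = 1` on units (`hB`); if `i(χ₁, 1)` is reducible then
`χ₁ = ‖·‖` or `χ₁ = η · ‖·‖^{1∕2}` with `η` a continuous quadratic character extension (in fact the second).  PROOF: `by_cases` `v` unramified in `L` — ★ the all-inert closer
`ramifiedCharOne_depthZero_normTrivial_of_unramified` (this seat) ∕ ★ the ramified provider `R90.S1.exists_eta_of_reducible_ramified` (R90-C10-p08 (g2)).
[cite: Keys1984, §3, §7 Theorem (2) p. 126] [cite: Casselman1980, §3] [cite: Casselman1995, §6.4, Thm. 6.6.2] [cite: Rogawski1990, §12.2 (1)–(2) p. 173] [cite: MoyPrasad1996, §3] -/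
theorem keysThmTwo_ramifiedCharOne_depthZero_normTrivial :
    ∀ (L : Type) [Field L] [NumberField L] [IsCMField L] (v : HeightOneSpectrum (𝓞 ↥(maximalRealSubfield L))),
      (∀ w : PlacesOver L v, IsCMField.complexConj L • w.1 = w.1) →
      ∀ (χ₁ : (UnitaryGroup.LocalRing L v)ˣ →* ℂˣ),
        Continuous (fun x => ((χ₁ x : ℂˣ) : ℂ)) → (∃ x, ‖((χ₁ x : ℂˣ) : ℂ)‖ ≠ 1) →
        (∀ x : (UnitaryGroup.LocalRing L v)ˣ, unitModulusChar (UnitaryGroup.LocalRing L v) x < 1 → ‖((χ₁ x : ℂˣ) : ℂ)‖ < 1) →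
        ¬ (∀ u ∈ (Submonoid.pi Set.univ (fun w : PlacesOver L v => (w.1.adicCompletionIntegers L).toSubring.toSubmonoid)).units, χ₁ u = 1) →
        (∀ u : (UnitaryGroup.LocalRing L v)ˣ, (∀ w' : PlacesOver L v, Valued.v (((u : UnitaryGroup.LocalRing L v) w') - 1) < 1) → χ₁ u = 1) →
        (∀ u : (UnitaryGroup.LocalRing L v)ˣ, (∀ w' : PlacesOver L v, Valued.v ((u : UnitaryGroup.LocalRing L v) w') = 1) →
          χ₁ (u * Units.map (conjLocal L (IsCMField.complexConj L) v : UnitaryGroup.LocalRing L v →* UnitaryGroup.LocalRing L v) u) = 1) →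
        (∃ N : Subrepresentation (UnitaryGroup.cmPrincipalSeries L 3 v (UnitaryGroup.cmTorusCharPair L v χ₁ 1)), N ≠ ⊥ ∧ N ≠ ⊤) →
        χ₁ = halfModulusChar (UnitaryGroup.LocalRing L v) * halfModulusChar (UnitaryGroup.LocalRing L v) ∨
        (∃ η : (UnitaryGroup.LocalRing L v)ˣ →* ℂˣ, IsQuadraticCharExtension (conjLocal L (IsCMField.complexConj L) v) η ∧
          Continuous (fun x => ((η x : ℂˣ) : ℂ)) ∧ χ₁ = η * halfModulusChar (UnitaryGroup.LocalRing L v)) := by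
  intro L _ _ _ v hns χ₁ h₁ hnu hcontr hram hdepth hB hred
  by_cases hunr : Algebra.IsUnramifiedIn (𝓞 L) v.asIdeal
  · exact K2E3KeysThmTwoDepthZeroBranchBInertAll.ramifiedCharOne_depthZero_normTrivial_of_unramified L v hns hunr χ₁ h₁ hnu hcontr hram hdepth hB hred
  · exact Or.inr (R90.S1.exists_eta_of_reducible_ramified L v hns hunr χ₁ h₁ hnu hcontr hram hdepth hB hred)

end Summit.HodgeConjecture.HodgeConjecture.Cruxes.H413.K2E3KeysThmTwoContractingRamifiedCharOneDepthZero

end
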